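import Summits.Parity.BatemanHorn.Theorems.SoloInformedDivisorStoreyGeneral
import HarnessLib

/-!
# A root-family criterion for `Mid_g(x) ≫ x log x` (the located-root problem, lower-bound side)

[this work]  `Mid_g(x) = polyLocatedRootCount g x = #{(n, e) : n ≤ x, e ∣ g(n), x < e, e² < |g(n)|}`
is the open half of Erdős's divisor sum `S_g(x) = ∑_{n ≤ x} τ(|g(n)|) = 2A_g x log x + 2 Mid_g(x) + O(x)`
(`SoloInformedDivisorStoreyGeneral`).  For `deg g ≥ 3` this line has `Mid_g(x) ≥ c x log log x`
unconditionally (`SoloInformedLocatedRootLogLog`); the conjectured order is `x log x`.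

This file isolates the bookkeeping by which ANY explicit family of ideal / divisor "roots" feeds a
lower bound for `Mid_g`, in the shape produced by the largest-prime-factor literature
(Heath-Brown 2001 for `n³ + 2`; Irving 2015, Ermoshin 2026 for general cubics; Dartyge 2015,
de la Bretèche 2015, Dartyge–Maynard 2025 for special quartics), where one counts pairs
`(n, 𝔞)` with `𝔞 ∣ (n − θ)`, `N(𝔞)` in a window `(X^{1+κ}, X^{1+κ'})`, as `X·𝔐(X) + ℛ(X)`:

* `card_le_mul_card_locatedDivisors`, `sum_card_le_mul_polyLocatedRootCount` — a family of objects
  `t` attached to `n ≤ x`, each with an integer "norm" `N t ∣ g(n)`, `x < N t`, `(N t)² < |g(n)|`, and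
  at most `m` objects per norm, has at most `m · Mid_g(x)` members (injection into located pairs);
* `exists_eventually_mul_log_le_of_family` — if such family counts satisfy `𝒩(Y) = Y·𝔐(Y) + ℛ(Y)`
  with `𝒩(Y) ≤ m · Mid(x)` for `2Y ≤ x ≤ Y^{1+κ}`, `|ℛ(Y)| ≤ A·Y` and `𝔐(Y) ≥ c log Y` eventually,
  then `Mid(x) ≥ c' x log x` eventually (`c' = c/(12m)`);
* `eventually_mul_log_le_polyDivisorSum_of_located` — `Mid_g(x) ≥ c x log x` eventually gives
  `S_g(x) ≥ (2A_g + c) x log x` eventually, i.e. `lim inf S_g(x)/(x log x) > 2A_g`: the located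
  divisors carry a positive proportion of Erdős's sum (`deg g ≥ 2`, `g` irreducible).

The instance for `g = X³ + 2` (Heath-Brown's unsieved family of first-degree ideal pairs) is in
`SoloInformedUnsievedFamilyLocated`.  No path to the Bateman–Horn conjunct is claimed: this is the
`d ≥ 3` storey strictly below the parity wall.
-/

noncomputable section

open Finset Real Filter Polynomial

namespace Summit.Parity.BatemanHorn.Theorems

/-! ### Injection of a root family into located pairs -/

/-- **One argument `n`.** [this work]  Objects `t ∈ T` with norms `N t ∣ M`, `x < N t`,
`(N t)² < M` and at most `m` objects per norm: `#T ≤ m · #{e ∣ M : x < e, e² < M}`. -/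
theorem card_le_mul_card_locatedDivisors {ι : Type*} (T : Finset ι) (N : ι → ℕ) {M x m : ℕ}
    (hdvd : ∀ t ∈ T, N t ∣ M) (hgt : ∀ t ∈ T, x < N t) (hsq : ∀ t ∈ T, N t * N t < M)
    (hfib : ∀ t₀ ∈ T, #(T.filter fun t => N t = N t₀) ≤ m) :
    #T ≤ m * #(M.divisors.filter fun e => x < e ∧ e * e < M) := by
  classical
  have himg : T.image N ⊆ M.divisors.filter fun e => x < e ∧ e * e < M := by
    intro e he
    rw [mem_image] at he
    obtain ⟨t, ht, rfl⟩ := he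
    rw [mem_filter, Nat.mem_divisors]
    have hM : M ≠ 0 :=
      Nat.pos_iff_ne_zero.1 (lt_of_le_of_lt (Nat.zero_le _) (hsq t ht))
    exact ⟨⟨hdvd t ht, hM⟩, hgt t ht, hsq t ht⟩
  have hfib' : ∀ e ∈ T.image N, #(T.filter fun t => N t = e) ≤ m := by
    intro e he
    rw [mem_image] at he
    obtain ⟨t₀, ht₀, rfl⟩ := he
    exact hfib t₀ ht₀
  calc #T ≤ m * #(T.image N) := card_le_mul_card_image _ _ hfib'
    _ ≤ m * #(M.divisors.filter fun e => x < e ∧ e * e < M) :=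
        Nat.mul_le_mul_left _ (card_le_card himg)

/-- **Summed over `n`.** [this work]  Families `T n` (`n ∈ S ⊆ [1, x]`) of objects with norms
`N t ∣ g(n)`, `x < N t`, `(N t)² < |g(n)|`, at most `m` per norm and argument:
`∑_{n ∈ S} #T(n) ≤ m · Mid_g(x)`. -/
theorem sum_card_le_mul_polyLocatedRootCount {ι : Type*} (g : ℤ[X]) {x m : ℕ} {S : Finset ℕ}
    (hS : S ⊆ Icc 1 x) (T : ℕ → Finset ι) (N : ι → ℕ)
    (hdvd : ∀ n ∈ S, ∀ t ∈ T n, N t ∣ (g.eval (n : ℤ)).natAbs)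
    (hgt : ∀ n ∈ S, ∀ t ∈ T n, x < N t)
    (hsq : ∀ n ∈ S, ∀ t ∈ T n, N t * N t < (g.eval (n : ℤ)).natAbs)
    (hfib : ∀ n ∈ S, ∀ t₀ ∈ T n, #((T n).filter fun t => N t = N t₀) ≤ m) :
    ∑ n ∈ S, (#(T n) : ℝ) ≤ m * (polyLocatedRootCount g x : ℝ) := by
  have h1 : ∀ n ∈ S, (#(T n) : ℝ) ≤ (m : ℝ) * #(((g.eval (n : ℤ)).natAbs.divisors).filter
      fun e => x < e ∧ e * e < (g.eval (n : ℤ)).natAbs) := by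
    intro n hn
    exact_mod_cast card_le_mul_card_locatedDivisors (T n) N (hdvd n hn) (hgt n hn) (hsq n hn)
      (hfib n hn)
  calc ∑ n ∈ S, (#(T n) : ℝ)
      ≤ ∑ n ∈ S, (m : ℝ) * #(((g.eval (n : ℤ)).natAbs.divisors).filter
          fun e => x < e ∧ e * e < (g.eval (n : ℤ)).natAbs) := sum_le_sum h1
    _ ≤ ∑ n ∈ Icc 1 x, (m : ℝ) * #(((g.eval (n : ℤ)).natAbs.divisors).filter
          fun e => x < e ∧ e * e < (g.eval (n : ℤ)).natAbs) :=
        sum_le_sum_of_subset_of_nonneg hS (fun n _ _ => by positivity)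
    _ = m * (polyLocatedRootCount g x : ℝ) := by
        rw [← mul_sum, polyLocatedRootCount, Nat.cast_sum]

/-! ### From a family asymptotic `𝒩 = Y·𝔐 + ℛ` to `Mid(x) ≫ x log x` -/

/-- **The family criterion.** [this work]  Let `𝒩(Y) = Y·𝔐(Y) + ℛ(Y)` with `𝒩(Y) ≤ m·Mid(x)`
whenever `2Y ≤ x ≤ Y^{1+κ}` (`Y` large), `|ℛ(Y)| ≤ A·Y` and `𝔐(Y) ≥ c·log Y` eventually
(`κ, m, c > 0`).  Then `Mid(x) ≥ (c/(12m))·x·log x` eventually. -/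
theorem exists_eventually_mul_log_le_of_family {Mid N M R : ℕ → ℝ} {κ m A c : ℝ}
    (hκ : 0 < κ) (hm : 0 < m) (hc : 0 < c)
    (hN : ∀ Y, N Y = Y * M Y + R Y)
    (hMid : ∀ᶠ Y : ℕ in atTop, ∀ x : ℕ, 2 * Y ≤ x → (x : ℝ) ≤ (Y : ℝ) ^ (1 + κ) →
      N Y ≤ m * Mid x)
    (hR : ∀ᶠ Y : ℕ in atTop, |R Y| ≤ A * Y)
    (hM : ∀ᶠ Y : ℕ in atTop, c * Real.log Y ≤ M Y) :
    ∃ c' : ℝ, 0 < c' ∧ ∀ᶠ x : ℕ in atTop, c' * x * Real.log x ≤ Mid x := by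
  have hc0 : c ≠ 0 := hc.ne'
  have hm0 : m ≠ 0 := hm.ne'
  have hcount : ∀ᶠ Y : ℕ in atTop, c / 2 * Y * Real.log Y ≤ N Y := by
    have hlog : ∀ᶠ Y : ℕ in atTop, 2 * A / c ≤ Real.log Y :=
      (Real.tendsto_log_atTop.comp tendsto_natCast_atTop_atTop).eventually_ge_atTop _
    filter_upwards [hR, hM, hlog] with Y h1 h2 h3
    rw [hN]
    have hY0 : (0 : ℝ) ≤ Y := Nat.cast_nonneg _
    have h4 : -(A * Y) ≤ R Y := (abs_le.1 h1).1
    have h5 : (Y : ℝ) * (c * Real.log Y) ≤ Y * M Y := mul_le_mul_of_nonneg_left h2 hY0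
    have h6 : A ≤ c / 2 * Real.log Y := by
      have h7 : c / 2 * (2 * A / c) ≤ c / 2 * Real.log Y :=
        mul_le_mul_of_nonneg_left h3 (half_pos hc).le
      have e : c / 2 * (2 * A / c) = A := by
        field_simp
      linarith
    have h8 : A * Y ≤ c / 2 * Real.log Y * Y := mul_le_mul_of_nonneg_right h6 hY0
    linarith
  have hpow : ∀ᶠ Y : ℕ in atTop, (3 : ℝ) ≤ (Y : ℝ) ^ κ := by
    have h := ((tendsto_rpow_atTop hκ).comp tendsto_natCast_atTop_atTop).eventually_ge_atTop
      (3 : ℝ)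
    filter_upwards [h] with Y hY
    simpa using hY
  obtain ⟨Y₀, hY₀⟩ :=
    eventually_atTop.1 (hcount.and (hMid.and (hpow.and (eventually_ge_atTop 1))))
  refine ⟨c / (12 * m), by positivity, ?_⟩
  filter_upwards [eventually_ge_atTop (2 * Y₀ + 9)] with x hx
  obtain ⟨hcY, hMidY, hpowY, hY1⟩ := hY₀ (x / 2) (by omega)
  have hx1 : 2 * (x / 2) ≤ x := by omega
  have hx3 : x ≤ 3 * (x / 2) := by omega
  have hx9 : (9 : ℝ) ≤ x := by exact_mod_cast (show 9 ≤ x by omega)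
  have hxr : (x : ℝ) ≤ 3 * ((x / 2 : ℕ) : ℝ) := by exact_mod_cast hx3
  have hY1r : (1 : ℝ) ≤ ((x / 2 : ℕ) : ℝ) := by exact_mod_cast hY1
  have hY0 : (0 : ℝ) < ((x / 2 : ℕ) : ℝ) := by linarith
  have hx2 : (x : ℝ) ≤ ((x / 2 : ℕ) : ℝ) ^ (1 + κ) := by
    rw [Real.rpow_add hY0, Real.rpow_one]
    calc (x : ℝ) ≤ 3 * ((x / 2 : ℕ) : ℝ) := hxr
      _ = ((x / 2 : ℕ) : ℝ) * 3 := by ring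
      _ ≤ ((x / 2 : ℕ) : ℝ) * ((x / 2 : ℕ) : ℝ) ^ κ := mul_le_mul_of_nonneg_left hpowY hY0.le
  have hmid : N (x / 2) ≤ m * Mid x := hMidY x hx1 hx2
  have hYx : (x : ℝ) / 3 ≤ ((x / 2 : ℕ) : ℝ) := by linarith
  have hlogY : Real.log x / 2 ≤ Real.log ((x / 2 : ℕ) : ℝ) := by
    have h1 : Real.log x - Real.log 3 ≤ Real.log ((x / 2 : ℕ) : ℝ) := by
      rw [← Real.log_div (ne_of_gt (by linarith)) (by norm_num)]
      exact Real.log_le_log (by linarith) hYx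
    have h2 : Real.log 3 ≤ Real.log x / 2 := by
      have h9 : Real.log 9 = 2 * Real.log 3 := by
        rw [show (9 : ℝ) = 3 ^ 2 by norm_num, Real.log_pow]
        norm_num
      have h3 : Real.log 9 ≤ Real.log x := Real.log_le_log (by norm_num) hx9
      linarith
    linarith
  have hlogx0 : 0 ≤ Real.log x := Real.log_natCast_nonneg x
  have hlogY0 : 0 ≤ Real.log ((x / 2 : ℕ) : ℝ) := by linarith
  have key : m * (c / (12 * m) * x * Real.log x) ≤
      c / 2 * ((x / 2 : ℕ) : ℝ) * Real.log ((x / 2 : ℕ) : ℝ) := by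
    have e : m * (c / (12 * m) * x * Real.log x) = c / 2 * (x / 3) * (Real.log x / 2) := by
      field_simp
      ring
    rw [e]
    have ha : (0 : ℝ) ≤ c / 2 * (x / 3) := by positivity
    calc c / 2 * (x / 3) * (Real.log x / 2)
        ≤ c / 2 * (x / 3) * Real.log ((x / 2 : ℕ) : ℝ) := mul_le_mul_of_nonneg_left hlogY ha
      _ ≤ c / 2 * ((x / 2 : ℕ) : ℝ) * Real.log ((x / 2 : ℕ) : ℝ) := by
          have hb : c / 2 * (x / 3) ≤ c / 2 * ((x / 2 : ℕ) : ℝ) :=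
            mul_le_mul_of_nonneg_left hYx (half_pos hc).le
          exact mul_le_mul_of_nonneg_right hb hlogY0
  have hfin : m * (c / (12 * m) * x * Real.log x) ≤ m * Mid x := by linarith [hmid, hcY, key]
  exact le_of_mul_le_mul_left hfin hm

/-! ### The divisor-sum corollary -/

/-- **Located divisors carry a positive proportion of Erdős's sum.** [this work]  For `g`
irreducible of degree `≥ 2`: if `Mid_g(x) ≥ c·x·log x` eventually (`c > 0`), then
`S_g(x) ≥ (2A_g + c)·x·log x` eventually, `A_g = rootLevelConst g`. -/
theorem eventually_mul_log_le_polyDivisorSum_of_located {g : ℤ[X]} (hirr : Irreducible g)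
    (hdeg : 2 ≤ g.natDegree) {c : ℝ} (hc : 0 < c)
    (h : ∀ᶠ x : ℕ in atTop, c * x * Real.log x ≤ (polyLocatedRootCount g x : ℝ)) :
    ∀ᶠ x : ℕ in atTop,
      (2 * rootLevelConst g + c) * x * Real.log x ≤ (polyDivisorSum g x : ℝ) := by
  have hc0 : c ≠ 0 := hc.ne'
  obtain ⟨C, hC⟩ := exists_abs_polyDivisorSum_sub_located_sub_log_le_of_two_le hirr hdeg
  have hlog : ∀ᶠ x : ℕ in atTop, C / c ≤ Real.log x :=
    (Real.tendsto_log_atTop.comp tendsto_natCast_atTop_atTop).eventually_ge_atTop _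
  filter_upwards [h, hlog, eventually_ge_atTop 2] with x h1 h2 h3
  have h4 := (abs_le.1 (hC x h3)).1
  have hx0 : (0 : ℝ) ≤ x := Nat.cast_nonneg _
  have h5 : C ≤ c * Real.log x := by
    have h6 : c * (C / c) ≤ c * Real.log x := mul_le_mul_of_nonneg_left h2 hc.le
    have e : c * (C / c) = C := by
      field_simp
    linarith
  have h7 : C * x ≤ c * Real.log x * x := mul_le_mul_of_nonneg_right h5 hx0
  linarith [h4, h1, h7]

end Summit.Parity.BatemanHorn.Theorems
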